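import Summits.CriticalPhenomena.PercolationContinuityZ3.Theorems.PercNearOneGluingNoHeavyLowerTailSunflowerMultiPetalKempeMarkedTIRows
import HarnessLib
import HarnessLib.Audit

/-!
# `NoHeavyLowerTail` (crux stmt-CriticalPhenomena-4575), marked multigraphs, THEOREM TI2: the WEIGHTED `|S| = 1` ROWS when the special vertex IS the
# outer neighbour (`S = {s}`) — finite paired-row checks for both weight colours

Support file (seat `prim-l12-p2` gen 52; `--supports stmt-CriticalPhenomena-4575`; continuation of `…KempeMarkedTIRows`).  Finite checks only (`decide +kernel`
through the `ℕ`-indexed tables of `…TIRows`); no `sorry`; nothing is asserted about the crux.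
Memo: run/shared/lean/prim/prim-l12/prim-l12-p2/PROOF-TI2-MARKED-MULTIGRAPHS-g51.md §3 ((e) `s near`, (d) mirrored; the enumeration `smalld_ti2s.c`).

When `S = {s}` the three cells of a row `{ρ[s ↦ 0], ρ[s ↦ 1], ρ[s ↦ 2]}` carry DIFFERENT weights: the cell where `s` takes the weight colour `c` is a `K⁺`-cell
(weight `1`, shift `e_c`), the other two are `K`-cells (weight `2`); the law is `TI(K) ≥ TI(K−y) + TI((K−y)/(su))` (`(α,β) = (1,−1,0)`), the contraction
term sitting in the cell `s ↦ 0`.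
* `rowNearW c` — the near row for weight colour `c`; `rowNearN`, `rowNearW_eq_rowNearN`;
* **`near_pair_zero`, `near_pair_one`** — paired near rows `≥ 0` for `c = 0` and `c = 1` over g49's abstract parameter space (`12 × 3⁹` cases each;
  verified beforehand in C, work/py/t34.c).
-/

namespace Summit.CriticalPhenomena.PercolationContinuityZ3.Theorems.SunflowerPartition.Kempe

open Finset

/-- The NEAR row for weight colour `c` (`S = {s}`, law `(1,−1,0)`): cell `s ↦ c'` has weight `1` and shift `e_c` iff `c' = c`. [this work] -/
def rowNearW (c : Fin 3) (t φ : CType) (A B C : Fin 3) : ℤ :=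
  cellW (if c = 0 then 1 else 2) 1 (-1) (if c = 0 then (1, 0, 0) else (0, 0, 0)) (ctAdd t (xPart 0 φ)) (capAdd A C, B, 0)
    + cellW (if c = 1 then 1 else 2) 1 0 (if c = 1 then (0, 1, 0) else (0, 0, 0)) (ctAdd t (xPart 1 φ)) (A, capAdd B C, 0)
    + cellW (if c = 2 then 1 else 2) 1 0 (if c = 2 then (0, 0, 1) else (0, 0, 0)) (ctAdd t (xPart 2 φ)) (A, B, C)

/-- `rowNearW` as an `ℕ`-indexed table. [this work] -/
def rowNearN (c : ℕ) (t0 t1 t2 p0 p1 p2 A B C : ℕ) : ℤ :=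
  cellN (if c = 0 then 1 else 2) 1 (-1) (if c = 0 then 1 else 0) 0 0 (cap2 (t0 + p0)) t1 t2 (cap2 (A + C)) B 0
    + cellN (if c = 1 then 1 else 2) 1 0 0 (if c = 1 then 1 else 0) 0 t0 (cap2 (t1 + p1)) t2 A (cap2 (B + C)) 0
    + cellN (if c = 2 then 1 else 2) 1 0 0 0 (if c = 2 then 1 else 0) t0 t1 (cap2 (t2 + p2)) A B C

/-- `rowNearW 0` evaluates through `rowNearN 0`. [this work] -/
theorem rowNearW_zero_eq (t φ : CType) (A B C : Fin 3) :
    rowNearW 0 t φ A B C = rowNearN 0 t.1.val t.2.1.val t.2.2.val φ.1.val φ.2.1.val φ.2.2.val A.val B.val C.val := by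
  obtain ⟨t0, t1, t2⟩ := t
  obtain ⟨p0, p1, p2⟩ := φ
  unfold rowNearW rowNearN
  simp only [if_true, show ¬((0 : Fin 3) = 1) by decide, show ¬((0 : Fin 3) = 2) by decide, if_false, show ¬((0 : ℕ) = 1) by decide,
    show ¬((0 : ℕ) = 2) by decide]
  rw [xPart_zero_eq, xPart_one_eq, xPart_two_eq, cellW_eq_cellN, cellW_eq_cellN, cellW_eq_cellN]
  unfold ctAdd
  simp only [MGraph.capAdd_zero_right, ← cap2_val, Fin.val_zero, Fin.val_one]

/-- `rowNearW 1` evaluates through `rowNearN 1`. [this work] -/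
theorem rowNearW_one_eq (t φ : CType) (A B C : Fin 3) :
    rowNearW 1 t φ A B C = rowNearN 1 t.1.val t.2.1.val t.2.2.val φ.1.val φ.2.1.val φ.2.2.val A.val B.val C.val := by
  obtain ⟨t0, t1, t2⟩ := t
  obtain ⟨p0, p1, p2⟩ := φ
  unfold rowNearW rowNearN
  simp only [if_true, show ¬((1 : Fin 3) = 0) by decide, show ¬((1 : Fin 3) = 2) by decide, if_false, show ¬((1 : ℕ) = 0) by decide,
    show ¬((1 : ℕ) = 2) by decide]
  rw [xPart_zero_eq, xPart_one_eq, xPart_two_eq, cellW_eq_cellN, cellW_eq_cellN, cellW_eq_cellN]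
  unfold ctAdd
  simp only [MGraph.capAdd_zero_right, ← cap2_val, Fin.val_zero, Fin.val_one]

/-- Near rows, weight at `u`, `ℕ`-indexed form. (finite check, kernel) [this work] -/
theorem near_pair_zeroN : ∀ A : Fin 3, A ≠ 0 → ∀ C : Fin 3, C ≠ 0 → ∀ B Ia Ic P P' B₁ N Ta Tb Tc : Fin 3,
    0 ≤ rowNearN 0 (cap2 (Ia.val + P.val)) B₁.val Ic.val (cap2 (N.val + Ta.val)) Tb.val Tc.val A.val B.val C.val
      + rowNearN 0 (cap2 (Ic.val + P'.val)) B₁.val Ia.val (cap2 (N.val + Tc.val)) Tb.val Ta.val A.val B.val C.val := by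
  decide +kernel

/-- Near rows, weight at `v`, `ℕ`-indexed form. (finite check, kernel) [this work] -/
theorem near_pair_oneN : ∀ A : Fin 3, A ≠ 0 → ∀ C : Fin 3, C ≠ 0 → ∀ B Ia Ic P P' B₁ N Ta Tb Tc : Fin 3,
    0 ≤ rowNearN 1 (cap2 (Ia.val + P.val)) B₁.val Ic.val (cap2 (N.val + Ta.val)) Tb.val Tc.val A.val B.val C.val
      + rowNearN 1 (cap2 (Ic.val + P'.val)) B₁.val Ia.val (cap2 (N.val + Tc.val)) Tb.val Ta.val A.val B.val C.val := by
  decide +kernel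

/-- **NEAR, weight at `u`**: the weighted near row of a colouring plus that of its `Φ_u`-partner is `≥ 0`. [this work] -/
theorem near_pair_zero (A B C : Fin 3) (hA : A ≠ 0) (hC : C ≠ 0) (Ia Ic P P' B₁ N Ta Tb Tc : Fin 3) :
    0 ≤ rowNearW 0 (capAdd Ia P, B₁, Ic) (capAdd N Ta, Tb, Tc) A B C + rowNearW 0 (capAdd Ic P', B₁, Ia) (capAdd N Tc, Tb, Ta) A B C := by
  rw [rowNearW_zero_eq, rowNearW_zero_eq]
  simp only [← cap2_val]
  exact near_pair_zeroN A hA C hC B Ia Ic P P' B₁ N Ta Tb Tc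

/-- **NEAR, weight at `v`**: the weighted near row of a colouring plus that of its `Φ_u`-partner is `≥ 0`. [this work] -/
theorem near_pair_one (A B C : Fin 3) (hA : A ≠ 0) (hC : C ≠ 0) (Ia Ic P P' B₁ N Ta Tb Tc : Fin 3) :
    0 ≤ rowNearW 1 (capAdd Ia P, B₁, Ic) (capAdd N Ta, Tb, Tc) A B C + rowNearW 1 (capAdd Ic P', B₁, Ia) (capAdd N Tc, Tb, Ta) A B C := by
  rw [rowNearW_one_eq, rowNearW_one_eq]
  simp only [← cap2_val]
  exact near_pair_oneN A hA C hC B Ia Ic P P' B₁ N Ta Tb Tc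

end Summit.CriticalPhenomena.PercolationContinuityZ3.Theorems.SunflowerPartition.Kempe
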